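import Literature.NumberTheory.EllipticCurves.BhargavaShankarSolubleCosets
import Literature.NumberTheory.EllipticCurves.BinaryQuarticStabilizerTorsion
import Mathlib.GroupTheory.QuotientGroup.Defs
import HarnessLib

/-!
# Bhargava–Shankar, Lemma 5.10 (= Thm 3.2 of the published version): the `K`-soluble
# `PGL₂(K)`-classes of binary quartic forms with invariants `(I, J)` are in bijection with
# `E_{I,J}(K)/2E_{I,J}(K)`

Topic `Literature/NumberTheory/EllipticCurves`; assembly of `BhargavaShankarSolubleOrbits.lean`
(normal forms `f_P`, `f_O`; every soluble class is one of theirs),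
`BhargavaShankarTrivialClass.lean` (`f_P ∼ f_O ↔ P ∈ 2E(K)`) and
`BhargavaShankarSolubleCosets.lean` (`f_P ∼ f_Q ↔ Q ∈ P + 2E(K)`).

Source: M. Bhargava, A. Shankar, *Binary quartic forms having bounded invariants, and the
boundedness of the average rank of elliptic curves*, Ann. of Math. (2) 181 (2015) 191–242, §5.2 of
the held arXiv text `arXiv:1006.1002v2`:

> **Lemma 5.10.** Let `E` be an elliptic curve over a field `K` having invariants `I ≠ 0` and
> `J ≠ 0`. Then there exists a natural map `Q_E : E(K)/2E(K) → {K-equivalence classes of quartics}`.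
> This map is injective and the image consists exactly of the `K`-soluble `K`-equivalence classes
> of quartics having invariants equal to `I` and `J`.

(Thm 3.2 of the published version: "there exists a bijection between elements in `E(K)/2E(K)` and
`K`-soluble `PGL₂(K)`-orbits of binary quartic forms having invariants equal to `I` and `J`".)
Here, for `E = E_{I,J} : y² = x³ − (I/3)x − J/27` (`curveOfInvariants K I J`) over a field `K` of
characteristic `0` and `4I³ − J² ≠ 0` (no condition `I, J ≠ 0` is needed):

* `BinaryQuartic.pointForm I J : E_{I,J}(K) → V_K` — the representatives `O ↦ f_O`, `P ↦ f_P` of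
  `Q_E`; `BinaryQuartic.solubleForms I J` — the `K`-soluble forms with invariants `(I, J)`, with
  the equivalence relation `BinaryQuartic.pgl2Setoid I J` of `PGL₂(K)`-equivalence (twisted
  action; = `K`-equivalence for forms with the same invariants);
* `BinaryQuartic.pgl2Equiv_pointForm_iff` — **`Q_E` is well defined and injective**:
  `f_P ∼ f_Q ↔ P ≡ Q (mod 2E(K))` for all `P, Q ∈ E(K)` (including `O`);
* `BinaryQuartic.exists_pgl2Equiv_pointForm` — **the image is all soluble classes**;
* `BinaryQuartic.solubleClassesEquiv` — **the bijection
  `{K-soluble classes with invariants (I,J)} ≃ E_{I,J}(K)/2E_{I,J}(K)`**, and its cardinality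
  form `BinaryQuartic.natCard_solubleClasses_eq` (the count entering Prop. 5.12:
  `Σ_{f ∈ B_p^{I,J}} 1/#Aut(f) = Σ_{σ ∈ E/2E} 1/#E[2](ℚ_p)`, together with Lemma 5.11 =
  `BinaryQuartic.pgl2StabilizerCard_eq_natCard_torsionBy_two`, restated here for the forms in
  `solubleForms I J` as `BinaryQuartic.pgl2StabilizerCard_eq_of_mem_solubleForms`: every such
  form has exactly `#E_{I,J}(K)[2]` stabilising elements in `PGL₂(K)`).

## References

* M. Bhargava, A. Shankar, Ann. of Math. (2) 181 (2015) 191–242, Lemma 5.10 (arXiv:1006.1002v2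
  numbering; Thm 3.2 of the published version). [cite: BhargavaShankarAnnals2015, Lemma 5.10 (arXiv:1006.1002v2 numbering)]
* J. E. Cremona, *Classical invariants and 2-descent on elliptic curves*, J. Symbolic Comput. 31
  (2001) 71–87, Prop. 4.3. [cite: Cremona2001, Prop. 4.3]

## Design

`2E(K)` is the range of `zsmulAddGroupHom 2` (as in `localSelmerRatio`), `E(K)/2E(K)` the
`QuotientAddGroup` quotient; classes of forms are a `Quotient` of the subtype of soluble forms with
invariants `(I, J)` by `PGL₂(K)`-equivalence. Characteristic `0` as in the companion files.
-/

noncomputable section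

open scoped Classical

namespace Literature.NumberTheory.EllipticCurves

namespace BinaryQuartic

variable {K : Type*} [Field K] [CharZero K]

/-! ## The representatives `Q_E(P)` and the set of soluble forms -/

omit [CharZero K] in
/-- The representative quartic of the class `Q_E(P)`: `f_O` for `P = O` and `f_P` for an affine
point `P = (ξ, η)` (Bhargava–Shankar, Lemma 5.10; explicit forms of the companion file).
[cite: BhargavaShankarAnnals2015, Lemma 5.10 (arXiv:1006.1002v2 numbering)] -/
def pointForm (I J : K) : (curveOfInvariants K I J).toAffine.Point → BinaryQuartic K
  | .zero => trivialQuartic I J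
  | .some ξ η _ => quarticOfPoint I ξ η

omit [CharZero K] in
/-- `Q_E(O) = [f_O]` (definitional). [cite: BhargavaShankarAnnals2015, Lemma 5.10 (arXiv:1006.1002v2 numbering)] -/
@[simp] theorem pointForm_zero (I J : K) : pointForm I J 0 = trivialQuartic I J := rfl

omit [CharZero K] in
/-- `Q_E(P) = [f_P]` for affine `P` (definitional). [cite: BhargavaShankarAnnals2015, Lemma 5.10 (arXiv:1006.1002v2 numbering)] -/
@[simp] theorem pointForm_some (I J : K) {ξ η : K}
    (h : (curveOfInvariants K I J).toAffine.Nonsingular ξ η) :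
    pointForm I J (.some _ _ h) = quarticOfPoint I ξ η := rfl

omit [CharZero K] in
/-- The `K`-soluble binary quartic forms over `K` with invariants exactly `(I, J)` (the set whose
classes Lemma 5.10 parametrizes). [cite: BhargavaShankarAnnals2015, Lemma 5.10 (arXiv:1006.1002v2 numbering)] -/
def solubleForms (I J : K) : Set (BinaryQuartic K) :=
  {f | f.I = I ∧ f.J = J ∧ f.IsSoluble}

omit [CharZero K] in
/-- Membership in `solubleForms` (unfolding). [folklore] -/
theorem mem_solubleForms_iff (I J : K) (f : BinaryQuartic K) :
    f ∈ solubleForms I J ↔ f.I = I ∧ f.J = J ∧ f.IsSoluble := Iff.rfl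

/-- `Q_E(P)` is a `K`-soluble form with invariants `(I, J)`. [cite: BhargavaShankarAnnals2015, Lemma 5.10 (arXiv:1006.1002v2 numbering)] -/
theorem pointForm_mem_solubleForms (I J : K) (P : (curveOfInvariants K I J).toAffine.Point) :
    pointForm I J P ∈ solubleForms I J := by
  rcases P with _ | ⟨ξ, η, h⟩
  · exact ⟨I_trivialQuartic I J, J_trivialQuartic I J, isSoluble_trivialQuartic I J⟩
  · exact ⟨I_quarticOfPoint I ξ η, (J_quarticOfPoint_eq_iff I J ξ η).mpr h.1,
      isSoluble_quarticOfPoint I ξ η⟩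

omit [CharZero K] in
/-- `PGL₂(K)`-equivalence (twisted action) as an equivalence relation on the soluble forms with
invariants `(I, J)`; for forms with the same invariants this is `K`-equivalence
(Bhargava–Shankar, proof of Thm 5.6). [cite: BhargavaShankarAnnals2015, §5.1 (K-equivalence; arXiv:1006.1002v2 numbering)] -/
def pgl2Setoid (I J : K) : Setoid (solubleForms I J) where
  r f g := PGL2Equiv f.1 g.1
  iseqv := ⟨fun f ↦ PGL2Equiv.refl f.1, fun h ↦ h.symm, fun h₁ h₂ ↦ h₁.trans h₂⟩

/-! ## `Q_E` is well defined, injective, and onto the soluble classes -/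

/-- **Well-definedness and injectivity of `Q_E`** (Bhargava–Shankar, Lemma 5.10): for all
`P, Q ∈ E_{I,J}(K)`, `Q_E(P) ∼ Q_E(Q)` iff `P ≡ Q (mod 2E_{I,J}(K))`.
[cite: BhargavaShankarAnnals2015, Lemma 5.10 (arXiv:1006.1002v2 numbering)] -/
theorem pgl2Equiv_pointForm_iff {I J : K} (hΔ : 4 * I ^ 3 - J ^ 2 ≠ 0)
    (P Q : (curveOfInvariants K I J).toAffine.Point) :
    PGL2Equiv (pointForm I J P) (pointForm I J Q) ↔
      (QuotientAddGroup.mk P : (curveOfInvariants K I J).toAffine.Point ⧸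
          (zsmulAddGroupHom (α := (curveOfInvariants K I J).toAffine.Point) 2).range) =
        QuotientAddGroup.mk Q := by
  rw [QuotientAddGroup.eq]
  rcases P with _ | ⟨ξ, η, hP⟩ <;> rcases Q with _ | ⟨ξ', η', hQ⟩
  · simp only [pointForm, ← WeierstrassCurve.Affine.Point.zero_def, neg_zero, add_zero]
    exact ⟨fun _ ↦ zero_mem _, fun _ ↦ PGL2Equiv.refl _⟩
  · rw [← WeierstrassCurve.Affine.Point.zero_def, neg_zero, zero_add, pointForm_zero, pointForm_some]
    rw [← pgl2Equiv_trivialQuartic_iff_mem_range_two hΔ hQ]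
    exact ⟨fun h ↦ h.symm, fun h ↦ h.symm⟩
  · rw [← WeierstrassCurve.Affine.Point.zero_def, add_zero, neg_mem_iff, pointForm_zero,
      pointForm_some]
    exact pgl2Equiv_trivialQuartic_iff_mem_range_two hΔ hP
  · rw [pointForm_some, pointForm_some, pgl2Equiv_quarticOfPoint_iff hΔ hP hQ,
      AddMonoidHom.mem_range]
    constructor
    · rintro ⟨R, hR⟩
      exact ⟨R, by rw [zsmulAddGroupHom_apply, two_zsmul, hR]; abel⟩
    · rintro ⟨R, hR⟩
      refine ⟨R, ?_⟩
      rw [zsmulAddGroupHom_apply, two_zsmul] at hR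
      rw [hR]; abel

/-- **The image of `Q_E` is every soluble class** (Bhargava–Shankar, Lemma 5.10): a `K`-soluble
form with invariants `(I, J)` is `PGL₂(K)`-equivalent to `Q_E(P)` for some `P ∈ E_{I,J}(K)`.
[cite: BhargavaShankarAnnals2015, Lemma 5.10 (arXiv:1006.1002v2 numbering)] -/
theorem exists_pgl2Equiv_pointForm {I J : K} (hΔ : 4 * I ^ 3 - J ^ 2 ≠ 0) {f : BinaryQuartic K}
    (hf : f ∈ solubleForms I J) :
    ∃ P : (curveOfInvariants K I J).toAffine.Point, PGL2Equiv f (pointForm I J P) := by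
  obtain ⟨hI, hJ, hsol⟩ := hf
  have hdisc : f.disc ≠ 0 := by
    intro h
    have h27 := twentySeven_mul_disc f
    rw [h, mul_zero, hI, hJ] at h27
    exact hΔ h27.symm
  rcases pgl2Equiv_normalForm hI hJ hdisc hsol with h | ⟨ξ, η, hP, h⟩
  · exact ⟨0, h⟩
  · exact ⟨.some _ _ hP, h⟩

/-! ## The bijection -/

/-- The class in `E(K)/2E(K)` attached to a soluble form: the class of any `P` with `f ∼ Q_E(P)`
(independent of the choice by `pgl2Equiv_pointForm_iff`). [cite: BhargavaShankarAnnals2015, Lemma 5.10 (arXiv:1006.1002v2 numbering)] -/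
def classOfForm {I J : K} (hΔ : 4 * I ^ 3 - J ^ 2 ≠ 0) (f : solubleForms I J) :
    (curveOfInvariants K I J).toAffine.Point ⧸
      (zsmulAddGroupHom (α := (curveOfInvariants K I J).toAffine.Point) 2).range :=
  QuotientAddGroup.mk (Classical.choose (exists_pgl2Equiv_pointForm hΔ f.2))

/-- The defining property of `classOfForm`: `f ∼ Q_E(P)` for the chosen `P`. [folklore] -/
theorem pgl2Equiv_pointForm_choose {I J : K} (hΔ : 4 * I ^ 3 - J ^ 2 ≠ 0) (f : solubleForms I J) :
    PGL2Equiv f.1 (pointForm I J (Classical.choose (exists_pgl2Equiv_pointForm hΔ f.2))) :=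
  Classical.choose_spec (exists_pgl2Equiv_pointForm hΔ f.2)

/-- `classOfForm f = [P]` whenever `f ∼ Q_E(P)`. [cite: BhargavaShankarAnnals2015, Lemma 5.10 (arXiv:1006.1002v2 numbering)] -/
theorem classOfForm_eq_mk {I J : K} (hΔ : 4 * I ^ 3 - J ^ 2 ≠ 0) (f : solubleForms I J)
    {P : (curveOfInvariants K I J).toAffine.Point} (h : PGL2Equiv f.1 (pointForm I J P)) :
    classOfForm hΔ f = QuotientAddGroup.mk P := by
  rw [classOfForm, ← pgl2Equiv_pointForm_iff hΔ]
  exact (pgl2Equiv_pointForm_choose hΔ f).symm.trans h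

/-- `classOfForm` is constant on `PGL₂(K)`-classes. [cite: BhargavaShankarAnnals2015, Lemma 5.10 (arXiv:1006.1002v2 numbering)] -/
theorem classOfForm_eq_of_pgl2Equiv {I J : K} (hΔ : 4 * I ^ 3 - J ^ 2 ≠ 0) {f g : solubleForms I J}
    (h : PGL2Equiv f.1 g.1) : classOfForm hΔ f = classOfForm hΔ g :=
  classOfForm_eq_mk hΔ f (h.trans (pgl2Equiv_pointForm_choose hΔ g))

/-- **Bhargava–Shankar, Lemma 5.10 (= Thm 3.2 of the published version): the `K`-soluble
`PGL₂(K)`-classes of binary quartic forms with invariants `(I, J)` are in canonical bijection with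
`E_{I,J}(K)/2E_{I,J}(K)`**, for `E_{I,J} : y² = x³ − (I/3)x − J/27` over a field of characteristic
`0` with `4I³ − J² ≠ 0`; the bijection sends the class of `f` to the class of any `P` with
`f ∼ Q_E(P)`, and its inverse is induced by `Q_E` (`pointForm`).
[cite: BhargavaShankarAnnals2015, Lemma 5.10 (arXiv:1006.1002v2 numbering)] -/
def solubleClassesEquiv {I J : K} (hΔ : 4 * I ^ 3 - J ^ 2 ≠ 0) :
    Quotient (pgl2Setoid I J) ≃
      (curveOfInvariants K I J).toAffine.Point ⧸
        (zsmulAddGroupHom (α := (curveOfInvariants K I J).toAffine.Point) 2).range :=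
  Equiv.ofBijective
    (Quotient.lift (classOfForm hΔ) fun _ _ h ↦ classOfForm_eq_of_pgl2Equiv hΔ h)
    (by
      constructor
      · intro a b hab
        induction a using Quotient.inductionOn with | h f =>
        induction b using Quotient.inductionOn with | h g =>
        simp only [Quotient.lift_mk] at hab
        apply Quotient.sound
        show PGL2Equiv f.1 g.1
        have hf := pgl2Equiv_pointForm_choose hΔ f
        have hg := pgl2Equiv_pointForm_choose hΔ g
        have hfg : (QuotientAddGroup.mk (Classical.choose (exists_pgl2Equiv_pointForm hΔ f.2)) :
            (curveOfInvariants K I J).toAffine.Point ⧸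
              (zsmulAddGroupHom (α := (curveOfInvariants K I J).toAffine.Point) 2).range) =
            QuotientAddGroup.mk (Classical.choose (exists_pgl2Equiv_pointForm hΔ g.2)) := hab
        rw [← pgl2Equiv_pointForm_iff hΔ] at hfg
        exact hf.trans (hfg.trans hg.symm)
      · intro c
        induction c using QuotientAddGroup.induction_on with | H P =>
        refine ⟨Quotient.mk _ ⟨pointForm I J P, pointForm_mem_solubleForms I J P⟩, ?_⟩
        simp only [Quotient.lift_mk]
        exact classOfForm_eq_mk hΔ _ (PGL2Equiv.refl _))

/-- The bijection on the class of a form `f ∼ Q_E(P)` is `[P]`. [cite: BhargavaShankarAnnals2015, Lemma 5.10 (arXiv:1006.1002v2 numbering)] -/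
theorem solubleClassesEquiv_mk {I J : K} (hΔ : 4 * I ^ 3 - J ^ 2 ≠ 0) (f : solubleForms I J)
    {P : (curveOfInvariants K I J).toAffine.Point} (h : PGL2Equiv f.1 (pointForm I J P)) :
    solubleClassesEquiv hΔ (Quotient.mk _ f) = QuotientAddGroup.mk P := by
  simp only [solubleClassesEquiv, Equiv.ofBijective_apply, Quotient.lift_mk]
  exact classOfForm_eq_mk hΔ f h

/-- **Bhargava–Shankar, Lemma 5.10, counting form**: the number of `K`-soluble `PGL₂(K)`-classes of
binary quartic forms with invariants `(I, J)` equals `#(E_{I,J}(K)/2E_{I,J}(K))` (as `Nat.card`s; both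
sides are `0` when infinite). With Lemma 5.11 (`pgl2StabilizerCard_eq_natCard_torsionBy_two`) this
is the input `Σ_{f ∈ B_p^{I,J}} 1/#Aut(f) = #(E/2E)/#E[2]` of Prop. 5.12.
[cite: BhargavaShankarAnnals2015, Lemma 5.10 (arXiv:1006.1002v2 numbering)] -/
theorem natCard_solubleClasses_eq {I J : K} (hΔ : 4 * I ^ 3 - J ^ 2 ≠ 0) :
    Nat.card (Quotient (pgl2Setoid I J)) =
      Nat.card ((curveOfInvariants K I J).toAffine.Point ⧸
        (zsmulAddGroupHom (α := (curveOfInvariants K I J).toAffine.Point) 2).range) :=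
  Nat.card_congr (solubleClassesEquiv hΔ)

/-- **Bhargava–Shankar, Lemma 5.11 for the parametrized classes** (the tree's
`pgl2StabilizerCard_eq_natCard_torsionBy_two` of `BinaryQuarticStabilizerTorsion.lean`, restated
on `solubleForms I J`): every `K`-soluble form with invariants `(I, J)` has a stabiliser in
`PGL₂(K)` of size `#E_{I,J}(K)[2]` — the same for all classes, so that with
`natCard_solubleClasses_eq` the mass `Σ_{classes} 1/#Stab` is `#(E/2E)/#E[2]` (Prop. 5.12).
[cite: BhargavaShankarAnnals2015, Lemmas 5.10–5.11 (arXiv:1006.1002v2 numbering)] -/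
theorem pgl2StabilizerCard_eq_of_mem_solubleForms {I J : K} (hΔ : 4 * I ^ 3 - J ^ 2 ≠ 0)
    {f : BinaryQuartic K} (hf : f ∈ solubleForms I J) :
    pgl2StabilizerCard f =
      Nat.card (AddSubgroup.torsionBy (curveOfInvariants K I J).toAffine.Point (2 : ℤ)) := by
  obtain ⟨hI, hJ, -⟩ := hf
  have hdisc : f.disc ≠ 0 := by
    intro h
    have h27 := twentySeven_mul_disc f
    rw [h, mul_zero, hI, hJ] at h27
    exact hΔ h27.symm
  rw [pgl2StabilizerCard_eq_natCard_torsionBy_two two_ne_zero three_ne_zero hdisc, hI, hJ]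
  rfl

end BinaryQuartic

end Literature.NumberTheory.EllipticCurves

end
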